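import Literature.Computability.Complexity.GateEliminationSubst

/-!
# Gate elimination, IV: deleting a gate (normalization Rule 1, with the potential count) and redirecting wires

Second layer of the toolkit for the one-step claim `LiYang2022_step` (Li–Yang, STOC 2022,
Thm. 4.1; full version ECCC TR21-023, §3.3 "Normalization of circuits" and §4.1), over the state
space of `GateEliminationStep.lean`; continues `GateEliminationSubst.lean`. Everything is PROVED.

* `Node.skip` / `Semicircuit.removeGate C k₀ ε` — **deleting a gate** `k₀` that no gate reads,
  the others reindexed by `ε : Fin m' ≃ {k ≠ k₀}` (`skipEquiv` is the canonical one,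
  `m' = m - 1`). Proved: solutions restrict and extend (`Consistent.removeGate`,
  `Consistent.extendVals`), so fairness is preserved (`Fair.removeGate`) and, if `k₀` is not the
  output, `f|_R` is still computed (`ComputesRestr.removeGate`); out-degrees drop exactly by the
  wires into `k₀` (`fanout_removeGate_add`).
* **Rule 1 with its accounting** (Li–Yang §3.3, Lemma 3.11: "`G` a `0`-gate fed by `I₁`, `I₂` …
  newly introduced troubled gates can only be `I₁`, `I₂`, or the gates fed by them … each input
  of `G` can produce a troubled gate or a pack, hence `ΔΦ ≤ 2`"): `near_of_new_troubled`
  localises the new troubled gates, `exists_packing_removeGate` builds the new packing (old packs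
  whose gates stay troubled, plus a pack for each input variable that acquired two new troubled
  readers) with `Φ' ≤ Φ + #{non-constant inputs of k₀}`, and `measure_removeGate_le` / `rule1` /
  `rule1_of_const` package it: a fair semicircuit computing `f|_R` with a packing loses the
  `0`-gate with `Δμ ≥ 1 - 2α_φ` (`≥ 1 - α_φ` if `k₀` is fed by a constant), for `α_φ, α_I ≥ 0`.
  The generic counting behind it: `card_add_card_sdiff_ge_of_pairwise` (dropped packs inject
  into un-troubled gates) and `exists_pairs_cover` (covering new elements by two sets that are
  singletons or adjacent pairs).
* `Semicircuit.redirect C k₀ v neg` — **moving the wires out of `k₀` to the node `v`**, negating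
  those inputs if `neg` (the rewiring of Rules 2 and 3: descendants of a trivialized gate read the
  constant it computes, descendants of a degenerate gate read its live input, "functions modified
  accordingly"). For an admissible target (`RedirectOK`: a wire of `k₀` or a non-gate) this is a
  semicircuit; if `k₀` does not read itself and its own equation forces the value `v ⊕ neg`, the
  gate equations are equivalent (`consistent_redirect_iff`), so fairness and `f|_R` are preserved
  (`Fair.redirect`, `ComputesRestr.redirect`), `k₀` becomes a `0`-gate (`fanout_redirect_self`)
  and `v` inherits its wires (`fanout_redirect_target`).

Not yet here: the combined accounting of Rules 2/3 (redirect then delete: `ΔΦ ≤ 1`), the output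
cases of Rule 3, Rules 4–5, and the facts excluding self-loops at gates fed by constants in fair
semicircuits (these need the affine structure of the xor-part, `GateEliminationAffine.lean`).

## References

* J. Li, T. Yang, *3.1n − o(n) circuit lower bounds for explicit functions*, STOC 2022
  [LiYang2022]; full version ECCC TR21-023: §3.3 (Rules 1–5, Prop. 3.10, Lemma 3.11, pp. 15–17),
  Def. 3.1–3.6.
-/

namespace Literature.Computability.Complexity

open Finset



namespace Node

variable {n m m' : ℕ}

/-- Reindex the gate nodes after deleting gate `k₀`: a remaining gate `k ≠ k₀` becomes
`ε.symm k`; the deleted gate (which by assumption is no longer wired) is sent to the junk constant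
`false`. [folklore] -/
def skip (k₀ : Fin m) (ε : Fin m' ≃ {k : Fin m // k ≠ k₀}) : Node n m → Node n m'
  | .const b => .const b
  | .var i => .var i
  | .gate k => if h : k = k₀ then .const false else .gate (ε.symm ⟨k, h⟩)

/-- The inverse reindexing: gate `k` of the smaller circuit is gate `ε k` of the larger. [folklore] -/
def unskip (k₀ : Fin m) (ε : Fin m' ≃ {k : Fin m // k ≠ k₀}) : Node n m' → Node n m
  | .const b => .const b
  | .var i => .var i
  | .gate k => .gate (ε k)

variable (k₀ : Fin m) (ε : Fin m' ≃ {k : Fin m // k ≠ k₀})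

/-- Reindexing a constant node. [folklore] -/
@[simp] theorem skip_const (b : Bool) : (Node.const b : Node n m).skip k₀ ε = .const b := rfl

/-- Reindexing a variable node. [folklore] -/
@[simp] theorem skip_var (i : Fin n) : (Node.var i : Node n m).skip k₀ ε = .var i := rfl

/-- Inverse reindexing of a constant node. [folklore] -/
@[simp] theorem unskip_const (b : Bool) : (Node.const b : Node n m').unskip k₀ ε = .const b := rfl

/-- Inverse reindexing of a variable node. [folklore] -/
@[simp] theorem unskip_var (i : Fin n) : (Node.var i : Node n m').unskip k₀ ε = .var i := rfl

/-- Inverse reindexing of a gate node. [folklore] -/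
@[simp] theorem unskip_gate (k : Fin m') : (Node.gate k : Node n m').unskip k₀ ε = .gate (ε k : Fin m) := rfl

/-- Reindexing a kept gate. [folklore] -/
theorem skip_gate_of_ne {k : Fin m} (h : k ≠ k₀) :
    (Node.gate k : Node n m).skip k₀ ε = .gate (ε.symm ⟨k, h⟩) := by
  simp [skip, h]

/-- Reindexing the image of a gate of the smaller circuit. [folklore] -/
@[simp] theorem skip_gate_coe (k : Fin m') :
    (Node.gate (ε k : Fin m) : Node n m).skip k₀ ε = .gate k := by
  rw [skip_gate_of_ne k₀ ε (ε k).2]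
  congr 1
  rw [Equiv.symm_apply_eq]

/-- `skip ∘ unskip = id`. [folklore] -/
@[simp] theorem skip_unskip (v : Node n m') : (v.unskip k₀ ε).skip k₀ ε = v := by
  cases v with
  | const b => rfl
  | var i => rfl
  | gate k => exact skip_gate_coe k₀ ε k

/-- `unskip ∘ skip = id` away from the deleted gate. [folklore] -/
theorem unskip_skip {v : Node n m} (hv : v ≠ .gate k₀) : (v.skip k₀ ε).unskip k₀ ε = v := by
  cases v with
  | const b => rfl
  | var i => rfl
  | gate k =>
    have h : k ≠ k₀ := fun h => hv (by rw [h])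
    rw [skip_gate_of_ne k₀ ε h]
    simp

/-- `skip` is injective away from the deleted gate. [folklore] -/
theorem skip_inj {u v : Node n m} (hu : u ≠ .gate k₀) (hv : v ≠ .gate k₀) :
    u.skip k₀ ε = v.skip k₀ ε ↔ u = v :=
  ⟨fun h => by rw [← unskip_skip k₀ ε hu, ← unskip_skip k₀ ε hv, h], fun h => by rw [h]⟩

/-- A reindexed node is a gate iff the node was the corresponding kept gate. [folklore] -/
theorem skip_eq_gate_iff {v : Node n m} {k : Fin m'} :
    v.skip k₀ ε = .gate k ↔ v = .gate (ε k : Fin m) := by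
  cases v with
  | const b => simp
  | var i => simp
  | gate k₁ =>
    by_cases h : k₁ = k₀
    · subst h
      simp only [skip, dite_true, reduceCtorEq, Node.gate.injEq, false_iff]
      exact fun h' => (ε k).2 h'.symm
    · rw [skip_gate_of_ne k₀ ε h]
      simp only [Node.gate.injEq]
      rw [Equiv.symm_apply_eq]
      exact ⟨fun h' => congrArg Subtype.val h', fun h' => Subtype.ext h'⟩

/-- A reindexed node is a variable iff the node was that variable. [folklore] -/
theorem skip_eq_var_iff {v : Node n m} {i : Fin n} : v.skip k₀ ε = .var i ↔ v = .var i := by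
  cases v with
  | const b => simp
  | var i' => simp
  | gate k₁ => by_cases h : k₁ = k₀ <;> simp [skip, h]

end Node

namespace Semicircuit

variable {n : ℕ} (C : Semicircuit n)

/-- **Deleting a gate** `k₀` (meant for a gate that is no longer wired, e.g. a `0`-gate that is
not the output — normalization Rule 1 of Li–Yang §3.3 — or a gate whose readers have been
redirected): the remaining gates are reindexed by `ε : Fin m' ≃ {k ≠ k₀}`, keeping their
functions, wires, and membership in the xor-part. [cite: LiYang2022, §3.3 (Rule 1)] -/
abbrev removeGate (k₀ : Fin C.m) {m' : ℕ} (ε : Fin m' ≃ {k : Fin C.m // k ≠ k₀}) : Semicircuit n where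
  m := m'
  op k := C.op (ε k)
  arg k a := (C.arg (ε k) a).skip k₀ ε
  out := C.out.skip k₀ ε
  xorPart := univ.filter fun k => (ε k : Fin C.m) ∈ C.xorPart
  isXorOp_of_mem k hk := C.isXorOp_of_mem _ (by simpa using hk)
  mem_of_arg_eq k hk a k' h := by
    simp only [mem_filter, mem_univ, true_and] at hk ⊢
    exact C.mem_of_arg_eq _ hk a _ ((Node.skip_eq_gate_iff k₀ ε).mp h)
  acyclic := by
    obtain ⟨ρ, hρ⟩ := C.acyclic
    refine ⟨fun k => ρ (ε k), fun k hk a k' h hk' => ?_⟩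
    simp only [mem_filter, mem_univ, true_and] at hk hk'
    exact hρ _ hk a _ ((Node.skip_eq_gate_iff k₀ ε).mp h) hk'

section RemoveGate

variable (k₀ : Fin C.m) {m' : ℕ} (ε : Fin m' ≃ {k : Fin C.m // k ≠ k₀})

/-- Number of gates after deletion. [folklore] -/
theorem removeGate_m : (C.removeGate k₀ ε).m = m' := rfl

/-- Wires after deletion. [folklore] -/
theorem removeGate_arg (k : Fin m') (a : Fin 2) :
    (C.removeGate k₀ ε).arg k a = (C.arg (ε k) a).skip k₀ ε := rfl

/-- Output after deletion. [folklore] -/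
theorem removeGate_out : (C.removeGate k₀ ε).out = C.out.skip k₀ ε := rfl

/-- The gate count drops by one: `m' + 1 = m`. [folklore] -/
theorem removeGate_m_add_one (k₀ : Fin C.m) {m' : ℕ} (ε : Fin m' ≃ {k : Fin C.m // k ≠ k₀}) :
    m' + 1 = C.m := by
  have h1 : Fintype.card (Fin m') = Fintype.card {k : Fin C.m // k ≠ k₀} := Fintype.card_congr ε
  simp only [Fintype.card_fin, Fintype.card_subtype_compl, Fintype.card_unique] at h1
  have := k₀.pos
  omega

/-! #### Semantics: solutions restrict and extend -/

/-- Restricting gate values to the kept gates. [folklore] -/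
abbrev restrictVals (w : Fin C.m → Bool) : Fin m' → Bool := fun k => w (ε k)

/-- Node values of reindexed nodes (other than the deleted gate) under restricted gate values.
[folklore] -/
theorem nodeVal_skip (x : Fin n → Bool) (w : Fin C.m → Bool) {v : Node n C.m} (hv : v ≠ .gate k₀) :
    (C.removeGate k₀ ε).nodeVal x (C.restrictVals k₀ ε w) (v.skip k₀ ε) = C.nodeVal x w v := by
  cases v with
  | const b => rfl
  | var i => rfl
  | gate k =>
    have h : k ≠ k₀ := fun h => hv (by rw [h])
    rw [Node.skip_gate_of_ne k₀ ε h]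
    show w (ε (ε.symm ⟨k, h⟩)) = w k
    rw [Equiv.apply_symm_apply]

variable {C k₀} in
/-- **Solutions restrict**: if no gate reads `k₀`, a solution of the gate equations of `C`
restricts to a solution for `C.removeGate k₀ ε`. [folklore] -/
theorem Consistent.removeGate (h0 : ∀ k a, C.arg k a ≠ .gate k₀) {x : Fin n → Bool}
    {w : Fin C.m → Bool} (hw : C.Consistent x w) :
    (C.removeGate k₀ ε).Consistent x (C.restrictVals k₀ ε w) := by
  intro k
  show w (ε k) = C.op (ε k) _ _
  rw [removeGate_arg, removeGate_arg, C.nodeVal_skip k₀ ε x w (h0 _ 0), C.nodeVal_skip k₀ ε x w (h0 _ 1)]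
  exact hw (ε k)

/-- Extending gate values of the smaller circuit by a value `b₀` for the deleted gate. [folklore] -/
def extendVals (w' : Fin m' → Bool) (b₀ : Bool) : Fin C.m → Bool :=
  fun k => if h : k = k₀ then b₀ else w' (ε.symm ⟨k, h⟩)

/-- The extension at the deleted gate. [folklore] -/
@[simp] theorem extendVals_self (w' : Fin m' → Bool) (b₀ : Bool) : C.extendVals k₀ ε w' b₀ k₀ = b₀ := by
  simp [extendVals]

/-- The extension at a kept gate. [folklore] -/
@[simp] theorem extendVals_coe (w' : Fin m' → Bool) (b₀ : Bool) (k : Fin m') :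
    C.extendVals k₀ ε w' b₀ (ε k) = w' k := by
  simp only [extendVals, (ε k).2, dite_false]
  congr 1
  exact ε.symm_apply_apply k

/-- Restricting the extension gives back the values. [folklore] -/
@[simp] theorem restrictVals_extendVals (w' : Fin m' → Bool) (b₀ : Bool) :
    C.restrictVals k₀ ε (C.extendVals k₀ ε w' b₀) = w' :=
  funext fun k => C.extendVals_coe k₀ ε w' b₀ k

/-- Node values under the extension do not depend on `b₀` away from the deleted gate, and agree
with the smaller circuit. [folklore] -/
theorem nodeVal_extendVals (x : Fin n → Bool) (w' : Fin m' → Bool) (b₀ : Bool) {v : Node n C.m}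
    (hv : v ≠ .gate k₀) :
    C.nodeVal x (C.extendVals k₀ ε w' b₀) v = (C.removeGate k₀ ε).nodeVal x w' (v.skip k₀ ε) := by
  rw [← C.nodeVal_skip k₀ ε x _ hv, restrictVals_extendVals]

/-- The value the deleted gate must take, given the values of the kept gates. [folklore] -/
def deletedVal (x : Fin n → Bool) (w' : Fin m' → Bool) : Bool :=
  C.op k₀ ((C.removeGate k₀ ε).nodeVal x w' ((C.arg k₀ 0).skip k₀ ε))
    ((C.removeGate k₀ ε).nodeVal x w' ((C.arg k₀ 1).skip k₀ ε))

variable {C k₀} in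
/-- **Solutions extend**: if no gate reads `k₀` (in particular `k₀` does not read itself), a
solution for `C.removeGate k₀ ε` extends — by the forced value of the deleted gate — to a
solution for `C`. [folklore] -/
theorem Consistent.extendVals (h0 : ∀ k a, C.arg k a ≠ .gate k₀) {x : Fin n → Bool}
    {w' : Fin m' → Bool} (hw' : (C.removeGate k₀ ε).Consistent x w') :
    C.Consistent x (C.extendVals k₀ ε w' (C.deletedVal k₀ ε x w')) := by
  intro k
  by_cases hk : k = k₀
  · subst hk
    rw [extendVals_self, C.nodeVal_extendVals k ε x w' _ (h0 k 0), C.nodeVal_extendVals k ε x w' _ (h0 k 1)]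
    rfl
  · obtain ⟨k', rfl⟩ : ∃ k' : Fin m', (ε k' : Fin C.m) = k := ⟨ε.symm ⟨k, hk⟩, by simp⟩
    rw [extendVals_coe, C.nodeVal_extendVals k₀ ε x w' _ (h0 _ 0),
      C.nodeVal_extendVals k₀ ε x w' _ (h0 _ 1)]
    exact hw' k'

variable {C k₀} in
/-- **Deleting an unread gate preserves fairness.** [cite: LiYang2022, §3.3 (Rule 1)] -/
theorem Fair.removeGate (hF : C.Fair) (h0 : ∀ k a, C.arg k a ≠ .gate k₀) : (C.removeGate k₀ ε).Fair := by
  intro x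
  obtain ⟨w, hw, huniq⟩ := hF x
  refine ⟨C.restrictVals k₀ ε w, hw.removeGate ε h0, fun w' hw' => ?_⟩
  have := huniq _ (hw'.extendVals ε h0)
  rw [← C.restrictVals_extendVals k₀ ε w' (C.deletedVal k₀ ε x w'), this]

variable {C k₀} in
/-- Under fairness, every solution of the smaller circuit is the restriction of the solution of
`C`. [folklore] -/
theorem eq_restrictVals_of_consistent (hF : C.Fair) (h0 : ∀ k a, C.arg k a ≠ .gate k₀)
    {x : Fin n → Bool} {w' : Fin m' → Bool} (hw' : (C.removeGate k₀ ε).Consistent x w')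
    {w : Fin C.m → Bool} (hw : C.Consistent x w) : w' = C.restrictVals k₀ ε w := by
  obtain ⟨w₀, -, huniq⟩ := hF x
  have h1 := huniq _ (hw'.extendVals ε h0)
  have h2 := huniq _ hw
  rw [← C.restrictVals_extendVals k₀ ε w' (C.deletedVal k₀ ε x w'), h1, ← h2]

/-! #### Out-degrees after deletion -/

/-- **Out-degrees after deleting `k₀`**: the out-degree of a node drops by the number of wires
from it into `k₀` ("the out-degree of `I₁` and `I₂` are decreased by one", Li–Yang Rule 1).
[cite: LiYang2022, §3.3 (Rule 1)] -/
theorem fanout_removeGate_add (h0 : ∀ k a, C.arg k a ≠ .gate k₀) {v : Node n C.m} (hv : v ≠ .gate k₀) :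
    (C.removeGate k₀ ε).fanout (v.skip k₀ ε) + (univ.filter fun a : Fin 2 => C.arg k₀ a = v).card =
      C.fanout v := by
  unfold fanout
  -- split the sum over the gates of `C` at `k₀` and reindex the rest by `ε`
  have hsplit := (Finset.sum_erase_add (s := univ) (a := k₀)
    (f := fun j : Fin C.m => (univ.filter fun a : Fin 2 => C.arg j a = v).card) (mem_univ _))
  rw [← hsplit]
  congr 1
  -- reindex `univ.erase k₀` by `ε`
  have : (univ.erase k₀ : Finset (Fin C.m)) = (univ : Finset (Fin m')).map
      ⟨fun k => (ε k : Fin C.m), fun a b h => ε.injective (Subtype.ext h)⟩ := by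
    ext k
    simp only [mem_erase, ne_eq, mem_univ, and_true, mem_map, Function.Embedding.coeFn_mk, true_and]
    constructor
    · intro hk; exact ⟨ε.symm ⟨k, hk⟩, by simp⟩
    · rintro ⟨k', rfl⟩; exact (ε k').2
  rw [this, sum_map]
  refine sum_congr rfl fun k _ => ?_
  simp only [Function.Embedding.coeFn_mk]
  congr 1
  ext a
  simp only [mem_filter, mem_univ, true_and]
  exact Node.skip_inj k₀ ε (h0 _ a) hv

/-- Out-degree of a variable after deletion. [cite: LiYang2022, §3.3 (Rule 1)] -/
theorem fanout_removeGate_var_add (h0 : ∀ k a, C.arg k a ≠ .gate k₀) (i : Fin n) :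
    (C.removeGate k₀ ε).fanout (.var i) + (univ.filter fun a : Fin 2 => C.arg k₀ a = .var i).card =
      C.fanout (.var i) := by
  have := C.fanout_removeGate_add k₀ ε h0 (v := .var i) (by simp)
  simpa using this

/-- Out-degree of a kept gate after deletion. [cite: LiYang2022, §3.3 (Rule 1)] -/
theorem fanout_removeGate_gate_add (h0 : ∀ k a, C.arg k a ≠ .gate k₀) (k : Fin m') :
    (C.removeGate k₀ ε).fanout (.gate k) +
        (univ.filter fun a : Fin 2 => C.arg k₀ a = .gate (ε k : Fin C.m)).card =
      C.fanout (.gate (ε k : Fin C.m)) := by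
  have := C.fanout_removeGate_add k₀ ε h0 (v := .gate (ε k : Fin C.m))
    (fun h => (ε k).2 (Node.gate.inj h))
  simpa using this

/-- A node not read by `k₀` keeps its out-degree. [folklore] -/
theorem fanout_removeGate_of_not_read (h0 : ∀ k a, C.arg k a ≠ .gate k₀) {v : Node n C.m}
    (hv : v ≠ .gate k₀) (hread : ∀ a, C.arg k₀ a ≠ v) :
    (C.removeGate k₀ ε).fanout (v.skip k₀ ε) = C.fanout v := by
  have := C.fanout_removeGate_add k₀ ε h0 hv
  rw [filter_eq_empty_iff.mpr fun a _ => hread a, card_empty, add_zero] at this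
  exact this

/-! #### Computing `f|_R` after deletion -/

variable {C k₀} in
/-- **Deleting an unread non-output gate keeps computing `f|_R`.** [cite: LiYang2022, §3.3 (Rule 1)] -/
theorem ComputesRestr.removeGate {f : (Fin n → ZMod 2) → Bool} {R : RdqSource n}
    (hC : C.ComputesRestr f R) (hF : C.Fair) (h0 : ∀ k a, C.arg k a ≠ .gate k₀) (hout : C.out ≠ .gate k₀) :
    (C.removeGate k₀ ε).ComputesRestr f R := by
  refine ⟨fun i hi => ?_, fun v hv w' hw' => ?_⟩
  · have h := C.fanout_removeGate_var_add k₀ ε h0 i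
    have h' := hC.1 i hi
    omega
  · obtain ⟨w, hw, -⟩ := hF (boolOfZMod2.symm v)
    rw [C.eq_restrictVals_of_consistent ε hF h0 hw' hw, removeGate_out, C.nodeVal_skip k₀ ε _ w hout]
    exact hC.2 v hv w hw

end RemoveGate

end Semicircuit


/-! ### Packings under change of the troubled set (generic counting) -/

/-- **Dropped packs inject into un-troubled gates.** For a family `P` of pairs with pairwise
distinct components (a packing) all lying in `T`, the pairs having both components in `T'` number
at least `|P| - |T \ T'|`; stated additively. [folklore] -/
theorem card_add_card_sdiff_ge_of_pairwise {α : Type*} [DecidableEq α] (P : Finset (α × α))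
    (T T' : Finset α) (hPT : ∀ p ∈ P, p.1 ∈ T ∧ p.2 ∈ T)
    (hdis : ∀ p ∈ P, ∀ p' ∈ P, p ≠ p' → p.1 ≠ p'.1 ∧ p.1 ≠ p'.2 ∧ p.2 ≠ p'.1 ∧ p.2 ≠ p'.2) :
    P.card ≤ (P.filter fun p => p.1 ∈ T' ∧ p.2 ∈ T').card + (T \ T').card := by
  set P' := P.filter fun p => p.1 ∈ T' ∧ p.2 ∈ T' with hP'
  let g : α × α → α := fun p => if p.1 ∈ T' then p.2 else p.1
  have hmaps : ∀ p ∈ P \ P', g p ∈ T \ T' := by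
    intro p hp
    rw [mem_sdiff] at hp
    obtain ⟨hp, hnp⟩ := hp
    have hnp' : ¬ (p.1 ∈ T' ∧ p.2 ∈ T') := fun h => hnp (mem_filter.mpr ⟨hp, h⟩)
    obtain ⟨h1, h2⟩ := hPT p hp
    simp only [g, mem_sdiff]
    split_ifs with h
    · exact ⟨h2, fun h' => hnp' ⟨h, h'⟩⟩
    · exact ⟨h1, h⟩
  have hinj : Set.InjOn g (P \ P' : Finset _) := by
    intro p hp p' hp' hgg
    rw [Finset.coe_sdiff, Set.mem_sdiff] at hp hp'
    by_contra hne
    have hd := hdis p hp.1 p' hp'.1 hne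
    simp only [g] at hgg
    split_ifs at hgg with h1 h2 h2
    · exact hd.2.2.2 hgg
    · exact hd.2.2.1 hgg
    · exact hd.2.1 hgg
    · exact hd.1 hgg
  have hcard : (P \ P').card ≤ (T \ T').card := card_le_card_of_injOn g hmaps hinj
  have hsub : P' ⊆ P := filter_subset _ _
  rw [card_sdiff_of_subset hsub] at hcard
  have := card_le_card hsub
  omega

/-- **Packing the new troubled gates.** If the new elements `N` (disjoint from the components of
the packs of `Q`) are covered by two sets `A`, `B`, each of which has at most one element or is a
pair `{u, v}` of "adjacent" elements, then `Q` extends by pairwise-disjoint adjacent pairs inside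
`N` to `Q'` with `|N| ≤ (|Q'| - |Q|) + 2`. This is the count behind "each input of `G` can produce
a troubled gate or a pack, hence `ΔΦ ≤ 2`" (Li–Yang §3.3, Rule 1). [cite: LiYang2022, §3.3 (Rule 1)] -/
theorem exists_pairs_cover {α : Type*} [DecidableEq α] (Adj : α → α → Prop) (Q : Finset (α × α))
    (N A B : Finset α) (hN : N ⊆ A ∪ B)
    (hA : A.card ≤ 1 ∨ ∃ u v, u ≠ v ∧ A = {u, v} ∧ Adj u v)
    (hB : B.card ≤ 1 ∨ ∃ u v, u ≠ v ∧ B = {u, v} ∧ Adj u v)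
    (hAN : A ⊆ N) (hBN : B ⊆ N)
    (hQN : ∀ p ∈ Q, p.1 ∉ N ∧ p.2 ∉ N) :
    ∃ Q' : Finset (α × α), Q ⊆ Q' ∧
      N.card ≤ (Q'.card - Q.card) + (if A = ∅ then 0 else 1) + (if B = ∅ then 0 else 1) ∧
      (∀ p ∈ Q' \ Q, p.1 ≠ p.2 ∧ p.1 ∈ N ∧ p.2 ∈ N ∧ Adj p.1 p.2) ∧
      (∀ p ∈ Q' \ Q, ∀ p' ∈ Q' \ Q, p ≠ p' → p.1 ≠ p'.1 ∧ p.1 ≠ p'.2 ∧ p.2 ≠ p'.1 ∧ p.2 ≠ p'.2) := by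
  have hNcard : N.card ≤ (A ∪ B).card := card_le_card hN
  -- Case 1: `A` is an adjacent pair
  rcases hA with hA1 | ⟨u, v, huv, rfl, hadj⟩
  · rcases hB with hB1 | ⟨u', v', huv', rfl, hadj'⟩
    · refine ⟨Q, subset_rfl, ?_, fun p hp => by simp at hp, fun p hp => by simp at hp⟩
      have := card_union_le A B
      have hAi : A.card ≤ (if A = ∅ then 0 else 1) := by
        split_ifs with h
        · simp [h]
        · exact hA1
      have hBi : B.card ≤ (if B = ∅ then 0 else 1) := by
        split_ifs with h
        · simp [h]
        · exact hB1
      omega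
    · -- add the pack `(u', v')`
      have hnot : (u', v') ∉ Q := fun h => (hQN _ h).1 (hBN (by simp))
      refine ⟨insert (u', v') Q, subset_insert _ _, ?_, fun p hp => ?_, fun p hp p' hp' hne => ?_⟩
      · rw [card_insert_of_notMem hnot, if_neg (show ({u', v'} : Finset α) ≠ ∅ by simp)]
        have h2 : ({u', v'} : Finset α).card = 2 := card_pair huv'
        have := card_union_le A ({u', v'} : Finset α)
        have hAi : 0 ≤ (if A = ∅ then 0 else 1) := Nat.zero_le _
        have hAi' : A.card ≤ (if A = ∅ then 0 else 1) := by
          split_ifs with h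
          · simp [h]
          · exact hA1
        omega
      · rw [mem_sdiff, mem_insert] at hp
        rcases hp with ⟨rfl | hp, hnq⟩
        · exact ⟨huv', hBN (by simp), hBN (by simp), hadj'⟩
        · exact absurd hp hnq
      · rw [mem_sdiff, mem_insert] at hp hp'
        rcases hp with ⟨rfl | hp, hnq⟩ <;> rcases hp' with ⟨rfl | hp', hnq'⟩
        · exact absurd rfl hne
        · exact absurd hp' hnq'
        · exact absurd hp hnq
        · exact absurd hp hnq
  · rcases hB with hB1 | ⟨u', v', huv', rfl, hadj'⟩
    · have hnot : (u, v) ∉ Q := fun h => (hQN _ h).1 (hAN (by simp))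
      refine ⟨insert (u, v) Q, subset_insert _ _, ?_, fun p hp => ?_, fun p hp p' hp' hne => ?_⟩
      · rw [card_insert_of_notMem hnot, if_neg (show ({u, v} : Finset α) ≠ ∅ by simp)]
        have h2 : ({u, v} : Finset α).card = 2 := card_pair huv
        have := card_union_le ({u, v} : Finset α) B
        have hBi' : B.card ≤ (if B = ∅ then 0 else 1) := by
          split_ifs with h
          · simp [h]
          · exact hB1
        omega
      · rw [mem_sdiff, mem_insert] at hp
        rcases hp with ⟨rfl | hp, hnq⟩
        · exact ⟨huv, hAN (by simp), hAN (by simp), hadj⟩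
        · exact absurd hp hnq
      · rw [mem_sdiff, mem_insert] at hp hp'
        rcases hp with ⟨rfl | hp, hnq⟩ <;> rcases hp' with ⟨rfl | hp', hnq'⟩
        · exact absurd rfl hne
        · exact absurd hp' hnq'
        · exact absurd hp hnq
        · exact absurd hp hnq
    · -- both are adjacent pairs: if they meet, one pack suffices; otherwise add both
      by_cases hmeet : Disjoint ({u, v} : Finset α) {u', v'}
      · have hnot : (u, v) ∉ Q := fun h => (hQN _ h).1 (hAN (by simp))
        have hnot' : (u', v') ∉ insert (u, v) Q := by
          rw [mem_insert, not_or]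
          refine ⟨fun h => ?_, fun h => (hQN _ h).1 (hBN (by simp))⟩
          have hu : u' = u := (Prod.mk.inj h).1
          exact (disjoint_left.mp hmeet (by simp : u ∈ ({u, v} : Finset α))) (by simp [hu])
        refine ⟨insert (u', v') (insert (u, v) Q), (subset_insert _ _).trans (subset_insert _ _),
          ?_, fun p hp => ?_, fun p hp p' hp' hne => ?_⟩
        · rw [card_insert_of_notMem hnot', card_insert_of_notMem hnot,
            if_neg (show ({u, v} : Finset α) ≠ ∅ by simp), if_neg (show ({u', v'} : Finset α) ≠ ∅ by simp)]
          have h2 : ({u, v} : Finset α).card = 2 := card_pair huv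
          have h2' : ({u', v'} : Finset α).card = 2 := card_pair huv'
          have := card_union_of_disjoint hmeet
          omega
        · simp only [mem_sdiff, mem_insert] at hp
          rcases hp with ⟨rfl | rfl | hp, hnq⟩
          · exact ⟨huv', hBN (by simp), hBN (by simp), hadj'⟩
          · exact ⟨huv, hAN (by simp), hAN (by simp), hadj⟩
          · exact absurd hp hnq
        · simp only [mem_sdiff, mem_insert] at hp hp'
          have hd := disjoint_left.mp hmeet
          have hu' : u ∉ ({u', v'} : Finset α) := hd (by simp)
          have hv'' : v ∉ ({u', v'} : Finset α) := hd (by simp)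
          simp only [mem_insert, mem_singleton, not_or] at hu' hv''
          rcases hp with ⟨rfl | rfl | hp, hnq⟩ <;> rcases hp' with ⟨rfl | rfl | hp', hnq'⟩
          · exact absurd rfl hne
          · exact ⟨fun h => hu'.1 h.symm, fun h => hv''.1 h.symm, fun h => hu'.2 h.symm,
              fun h => hv''.2 h.symm⟩
          · exact absurd hp' hnq'
          · exact ⟨hu'.1, hu'.2, hv''.1, hv''.2⟩
          · exact absurd rfl hne
          · exact absurd hp' hnq'
          · exact absurd hp hnq
          · exact absurd hp hnq
          · exact absurd hp hnq
      · have hnot : (u, v) ∉ Q := fun h => (hQN _ h).1 (hAN (by simp))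
        refine ⟨insert (u, v) Q, subset_insert _ _, ?_, fun p hp => ?_, fun p hp p' hp' hne => ?_⟩
        · rw [card_insert_of_notMem hnot, if_neg (show ({u, v} : Finset α) ≠ ∅ by simp),
            if_neg (show ({u', v'} : Finset α) ≠ ∅ by simp)]
          have h2 : ({u, v} : Finset α).card = 2 := card_pair huv
          have h2' : ({u', v'} : Finset α).card = 2 := card_pair huv'
          -- the union of two meeting pairs has at most three elements
          have hle : (({u, v} : Finset α) ∪ {u', v'}).card ≤ 3 := by
            have h1 : 1 ≤ (({u, v} : Finset α) ∩ {u', v'}).card := by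
              rw [Nat.one_le_iff_ne_zero, Ne, card_eq_zero, ← Ne, ← nonempty_iff_ne_empty]
              exact not_disjoint_iff_nonempty_inter.mp hmeet
            have := card_union_add_card_inter ({u, v} : Finset α) {u', v'}
            omega
          omega
        · rw [mem_sdiff, mem_insert] at hp
          rcases hp with ⟨rfl | hp, hnq⟩
          · exact ⟨huv, hAN (by simp), hAN (by simp), hadj⟩
          · exact absurd hp hnq
        · rw [mem_sdiff, mem_insert] at hp hp'
          rcases hp with ⟨rfl | hp, hnq⟩ <;> rcases hp' with ⟨rfl | hp', hnq'⟩
          · exact absurd rfl hne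
          · exact absurd hp' hnq'
          · exact absurd hp hnq
          · exact absurd hp hnq


namespace Semicircuit

variable {n : ℕ}

/-! ### Readers and out-degree -/

/-- A node of out-degree `0` is read by no gate. [folklore] -/
theorem fanout_eq_zero_iff (D : Semicircuit n) (v : Node n D.m) :
    D.fanout v = 0 ↔ ∀ k a, D.arg k a ≠ v := by
  unfold fanout
  rw [sum_eq_zero_iff]
  simp only [mem_univ, true_implies, card_eq_zero, filter_eq_empty_iff]

/-- A node is read by at most `fanout` many gates. [folklore] -/
theorem card_readers_le_fanout (D : Semicircuit n) (v : Node n D.m) :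
    (univ.filter fun k => ∃ a, D.arg k a = v).card ≤ D.fanout v := by
  unfold fanout
  rw [card_eq_sum_ones, ← sum_filter_add_sum_filter_not univ (fun k => ∃ a, D.arg k a = v)]
  refine le_add_right (sum_le_sum fun k hk => ?_)
  rw [mem_filter] at hk
  obtain ⟨a, ha⟩ := hk.2
  rw [Nat.one_le_iff_ne_zero, Ne, card_eq_zero, ← Ne, ← nonempty_iff_ne_empty]
  exact ⟨a, by simp [ha]⟩

/-- A troubled gate has out-degree `1`; in particular it is not a `0`-gate. [cite: LiYang2022, Def. 3.1] -/
theorem Troubled.fanout_eq {D : Semicircuit n} {k : Fin D.m} (h : D.Troubled k) : D.fanout (.gate k) = 1 :=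
  h.2.1

/-- Two troubled gates reading a common variable are adjacent. [cite: LiYang2022, Def. 3.1] -/
theorem adjacent_of_reads (D : Semicircuit n) {k k' : Fin D.m} {z : Fin n} (hk : ∃ a, D.arg k a = .var z)
    (hk' : ∃ a, D.arg k' a = .var z) : D.Adjacent k k' :=
  ⟨z, hk, hk'⟩

end Semicircuit

/-! ### Normalization Rule 1: deleting a `0`-gate, with the potential accounting -/

namespace Semicircuit

section Rule1

variable {n : ℕ} (C : Semicircuit n) (k₀ : Fin C.m) {m' : ℕ} (ε : Fin m' ≃ {k : Fin C.m // k ≠ k₀})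

/-- Wires of kept gates, read back in `C`: gate `k` of the smaller circuit reads the variable `z`
iff gate `ε k` did. [folklore] -/
theorem reads_var_removeGate_iff (k : Fin m') (z : Fin n) :
    (∃ a, (C.removeGate k₀ ε).arg k a = .var z) ↔ ∃ a, C.arg (ε k) a = .var z := by
  simp only [Node.skip_eq_var_iff]

/-- The set of wires of a kept gate consists of two variables iff it did in `C`. [folklore] -/
theorem range_arg_removeGate_eq_pair_iff (k : Fin m') (x y : Fin n) :
    Set.range ((C.removeGate k₀ ε).arg k) = {Node.var x, Node.var y} ↔
      Set.range (C.arg (ε k)) = {Node.var x, Node.var y} := by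
  have key : ∀ (u : Node n C.m) (i : Fin n), u.skip k₀ ε = .var i ↔ u = .var i :=
    fun u i => Node.skip_eq_var_iff k₀ ε
  constructor
  · intro h
    ext u
    constructor
    · rintro ⟨a, rfl⟩
      have : (C.arg (ε k) a).skip k₀ ε ∈ Set.range ((C.removeGate k₀ ε).arg k) := ⟨a, rfl⟩
      rw [h] at this
      rcases this with h1 | h1
      · exact Or.inl ((key _ _).mp h1)
      · exact Or.inr ((key _ _).mp h1)
    · intro hu
      rcases hu with rfl | rfl
      · have : (Node.var x : Node n m') ∈ Set.range ((C.removeGate k₀ ε).arg k) := by rw [h]; simp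
        obtain ⟨a, ha⟩ := this
        exact ⟨a, (key _ _).mp ha⟩
      · have : (Node.var y : Node n m') ∈ Set.range ((C.removeGate k₀ ε).arg k) := by rw [h]; simp
        obtain ⟨a, ha⟩ := this
        exact ⟨a, (key _ _).mp ha⟩
  · intro h
    ext u
    constructor
    · rintro ⟨a, rfl⟩
      have : C.arg (ε k) a ∈ Set.range (C.arg (ε k)) := ⟨a, rfl⟩
      rw [h] at this
      rcases this with h1 | h1
      · rw [removeGate_arg, h1]; simp
      · rw [Set.mem_singleton_iff] at h1
        rw [removeGate_arg, h1]; simp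
    · intro hu
      rcases hu with rfl | rfl
      · have : (Node.var x : Node n C.m) ∈ Set.range (C.arg (ε k)) := by rw [h]; simp
        obtain ⟨a, ha⟩ := this
        exact ⟨a, by rw [removeGate_arg, ha]; rfl⟩
      · have : (Node.var y : Node n C.m) ∈ Set.range (C.arg (ε k)) := by rw [h]; simp
        obtain ⟨a, ha⟩ := this
        exact ⟨a, by rw [removeGate_arg, ha]; rfl⟩

/-- **New troubled gates are next to the deleted gate**: if gate `ε k` was not troubled but `k`
is troubled after deleting the `0`-gate `k₀`, then `k₀` read the gate `ε k` or a variable read by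
it ("Newly introduced troubled gate can only be `I₁`, `I₂`, or the gates fed by them", Li–Yang
§3.3, Rule 1). [cite: LiYang2022, §3.3 (Rule 1)] -/
theorem near_of_new_troubled (h0 : ∀ k a, C.arg k a ≠ .gate k₀) {k : Fin m'}
    (hT' : (C.removeGate k₀ ε).Troubled k) (hT : ¬ C.Troubled (ε k)) :
    ∃ a, C.arg k₀ a = .gate (ε k : Fin C.m) ∨
      ∃ z, C.arg k₀ a = .var z ∧ ∃ a', C.arg (ε k) a' = .var z := by
  by_contra hcon
  push Not at hcon
  obtain ⟨hand, h1, x, y, hxy, hr, hx, hy⟩ := hT'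
  rw [range_arg_removeGate_eq_pair_iff] at hr
  have hxr : ∃ a', C.arg (ε k) a' = .var x := by
    have : (Node.var x : Node n C.m) ∈ Set.range (C.arg (ε k)) := by rw [hr]; simp
    exact this
  have hyr : ∃ a', C.arg (ε k) a' = .var y := by
    have : (Node.var y : Node n C.m) ∈ Set.range (C.arg (ε k)) := by rw [hr]; simp
    exact this
  apply hT
  refine ⟨hand, ?_, x, y, hxy, hr, ?_, ?_⟩
  · rw [← C.fanout_removeGate_of_not_read k₀ ε h0 (v := .gate (ε k : Fin C.m))
      (fun h => (ε k).2 (Node.gate.inj h)) fun a => (hcon a).1]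
    simpa using h1
  · rw [← C.fanout_removeGate_of_not_read k₀ ε h0 (v := .var x) (by simp)
      fun a ha => hxr.elim fun a' ha' => (hcon a).2 x ha a' ha']
    simpa using hx
  · rw [← C.fanout_removeGate_of_not_read k₀ ε h0 (v := .var y) (by simp)
      fun a ha => hyr.elim fun a' ha' => (hcon a).2 y ha a' ha']
    simpa using hy

/-- Adjacency transfers from `C` to the smaller circuit. [folklore] -/
theorem adjacent_removeGate_of (k k' : Fin m') (h : C.Adjacent (ε k) (ε k')) :
    (C.removeGate k₀ ε).Adjacent k k' := by
  obtain ⟨z, hz, hz'⟩ := h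
  exact ⟨z, (C.reads_var_removeGate_iff k₀ ε k z).mpr hz, (C.reads_var_removeGate_iff k₀ ε k' z).mpr hz'⟩

/-- **Rule 1 accounting.** Deleting a `0`-gate from a circuit with packing `𝒫` yields a packing
`𝒫'` of the smaller circuit with `Φ(C', 𝒫') ≤ Φ(C, 𝒫) + 2`: the old packs whose gates stay
troubled are kept (dropped packs inject into gates that stopped being troubled), the new
troubled gates lie next to the two inputs of the deleted gate, each input accounting for at most
one troubled gate or one new pack (Li–Yang §3.3, Rule 1: "each input of `G` can produce a troubled
gate or a pack, hence `ΔΦ ≤ 2`"). [cite: LiYang2022, §3.3 (Rule 1), Lemma 3.11] -/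
theorem exists_packing_removeGate (h0 : ∀ k a, C.arg k a ≠ .gate k₀)
    {P : Finset (Fin C.m × Fin C.m)} (hP : C.IsPacking P) :
    ∃ P' : Finset (Fin m' × Fin m'), (C.removeGate k₀ ε).IsPacking P' ∧
      (C.removeGate k₀ ε).potential P' ≤ C.potential P +
        ((univ : Finset (Fin 2)).filter fun a => ∀ b, C.arg k₀ a ≠ .const b).card := by
  classical
  set C' := C.removeGate k₀ ε with hC'
  -- troubled sets, in `Fin m'`
  set T' : Finset (Fin m') := univ.filter fun k => C'.Troubled k with hT'
  set Told : Finset (Fin m') := univ.filter fun k => C.Troubled (ε k) with hTold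
  set N : Finset (Fin m') := T' \ Told with hN
  -- the old packing, transported to `Fin m'`, and its surviving part
  set Pm : Finset (Fin m' × Fin m') :=
    univ.filter fun q => ((ε q.1 : Fin C.m), (ε q.2 : Fin C.m)) ∈ P with hPm
  set Pold : Finset (Fin m' × Fin m') := Pm.filter fun q => q.1 ∈ T' ∧ q.2 ∈ T' with hPold
  -- (1) `|Pm| = |P|`: every pack of `P` avoids the `0`-gate `k₀`
  have hk₀T : ¬ C.Troubled k₀ := fun h => by
    have := h.fanout_eq
    rw [(C.fanout_eq_zero_iff _).mpr h0] at this
    exact zero_ne_one this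
  let emb : (Fin m' × Fin m') ↪ (Fin C.m × Fin C.m) :=
    ⟨fun q => ((ε q.1 : Fin C.m), (ε q.2 : Fin C.m)), fun q q' h => by
      simp only [Prod.mk.injEq] at h
      exact Prod.ext (ε.injective (Subtype.ext h.1)) (ε.injective (Subtype.ext h.2))⟩
  have hPeq : P = Pm.map emb := by
    ext p
    rw [mem_map]
    constructor
    · intro hp
      obtain ⟨-, hT1, hT2, -⟩ := hP.1 p hp
      have h1 : p.1 ≠ k₀ := fun h => hk₀T (h ▸ hT1)
      have h2 : p.2 ≠ k₀ := fun h => hk₀T (h ▸ hT2)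
      refine ⟨(ε.symm ⟨p.1, h1⟩, ε.symm ⟨p.2, h2⟩), ?_, ?_⟩
      · rw [hPm, mem_filter]
        simpa using hp
      · simp [emb]
    · rintro ⟨q, hq, rfl⟩
      rw [hPm, mem_filter] at hq
      exact hq.2
  have hPm_card : Pm.card = P.card := by rw [hPeq, card_map]
  -- (2) dropped packs inject into un-troubled gates
  have hPmT : ∀ q ∈ Pm, q.1 ∈ Told ∧ q.2 ∈ Told := by
    intro q hq
    rw [hPm, mem_filter] at hq
    obtain ⟨-, hT1, hT2, -⟩ := hP.1 _ hq.2
    simp [hTold, hT1, hT2]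
  have hPm_dis : ∀ q ∈ Pm, ∀ q' ∈ Pm, q ≠ q' →
      q.1 ≠ q'.1 ∧ q.1 ≠ q'.2 ∧ q.2 ≠ q'.1 ∧ q.2 ≠ q'.2 := by
    intro q hq q' hq' hne
    rw [hPm, mem_filter] at hq hq'
    have hne' : emb q ≠ emb q' := fun h => hne (emb.injective h)
    have hd := hP.2 _ hq.2 _ hq'.2 hne'
    refine ⟨fun h => hd.1 (by rw [h]), fun h => hd.2.1 (by rw [h]), fun h => hd.2.2.1 (by rw [h]),
      fun h => hd.2.2.2 (by rw [h])⟩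
  have hdrop : Pm.card ≤ Pold.card + (Told \ T').card :=
    card_add_card_sdiff_ge_of_pairwise Pm Told T' hPmT hPm_dis
  -- (3) the new troubled gates, covered input by input of `k₀`
  let A : Fin 2 → Finset (Fin m') := fun a => N.filter fun k =>
    C.arg k₀ a = .gate (ε k : Fin C.m) ∨ ∃ z, C.arg k₀ a = .var z ∧ ∃ a', C.arg (ε k) a' = .var z
  have hNT' : N ⊆ T' := sdiff_subset
  have hT'mem : ∀ k, k ∈ T' ↔ C'.Troubled k := fun k => by simp [hT']
  have hNcov : N ⊆ A 0 ∪ A 1 := by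
    intro k hk
    have hk' := hk
    rw [hN, mem_sdiff, hT'mem] at hk'
    have hkT : ¬ C.Troubled (ε k) := fun h => hk'.2 (by simp [hTold, h])
    obtain ⟨a, ha⟩ := C.near_of_new_troubled k₀ ε h0 hk'.1 hkT
    rw [mem_union]
    fin_cases a
    · exact Or.inl (mem_filter.mpr ⟨hk, ha⟩)
    · exact Or.inr (mem_filter.mpr ⟨hk, ha⟩)
  let Adj : Fin m' → Fin m' → Prop := fun u v => C'.Troubled u ∧ C'.Troubled v ∧ C'.Adjacent u v
  -- a troubled gate of `C'` reading `z` makes `z` a `2`-variable of `C'`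
  have hfz : ∀ {k : Fin m'} {z : Fin n}, C'.Troubled k → (∃ a', C'.arg k a' = .var z) →
      C'.fanout (.var z) = 2 := by
    rintro k z ⟨-, -, x, y, -, hr, hx, hy⟩ ⟨a', ha'⟩
    have : (Node.var z : Node n m') ∈ Set.range (C'.arg k) := ⟨a', ha'⟩
    rw [hr] at this
    rcases this with h | h
    · rw [Node.var.injEq] at h; rw [h]; exact hx
    · rw [Set.mem_singleton_iff, Node.var.injEq] at h; rw [h]; exact hy
  have hAgood : ∀ a, (A a).card ≤ 1 ∨ ∃ u v, u ≠ v ∧ A a = {u, v} ∧ Adj u v := by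
    intro a
    cases hI : C.arg k₀ a with
    | const b =>
      left
      rw [card_eq_zero.mpr, Nat.le_iff_lt_or_eq]
      · exact Or.inl zero_lt_one
      · refine filter_eq_empty_iff.mpr fun k _ h => ?_
        rw [hI] at h
        rcases h with h | ⟨z, h, -⟩ <;> simp at h
    | gate g =>
      left
      refine card_le_one.mpr fun u hu v hv => ?_
      rw [mem_filter, hI] at hu hv
      rcases hu.2 with hu | ⟨z, hz, -⟩
      · rcases hv.2 with hv | ⟨z, hz, -⟩
        · rw [Node.gate.injEq] at hu hv
          exact ε.injective (Subtype.ext (hu.symm.trans hv))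
        · simp at hz
      · simp at hz
    | var z =>
      have hmemA : ∀ k, k ∈ A a ↔ k ∈ N ∧ ∃ a', C.arg (ε k) a' = .var z := by
        intro k
        rw [mem_filter, hI]
        simp only [reduceCtorEq, Node.var.injEq, false_or, exists_eq_left']
      have hsub : A a ⊆ univ.filter fun k => ∃ a', C'.arg k a' = .var z := by
        intro k hk
        rw [hmemA] at hk
        exact mem_filter.mpr ⟨mem_univ _, (C.reads_var_removeGate_iff k₀ ε k z).mpr hk.2⟩
      by_cases hne : (A a).Nonempty
      · obtain ⟨k₁, hk₁⟩ := hne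
        have hk₁' := (hmemA k₁).mp hk₁
        have hfz2 : C'.fanout (.var z) = 2 :=
          hfz ((hT'mem k₁).mp (hNT' hk₁'.1)) ((C.reads_var_removeGate_iff k₀ ε k₁ z).mpr hk₁'.2)
        have hcard2 : (A a).card ≤ 2 :=
          (card_le_card hsub).trans ((C'.card_readers_le_fanout (.var z)).trans hfz2.le)
        rcases Nat.lt_or_ge (A a).card 2 with hlt | hge
        · left; omega
        · right
          obtain ⟨u, v, huv, huvA⟩ := card_eq_two.mp (le_antisymm hcard2 hge)
          have hu := (hmemA u).mp (by rw [huvA]; simp)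
          have hv := (hmemA v).mp (by rw [huvA]; simp)
          refine ⟨u, v, huv, huvA, (hT'mem u).mp (hNT' hu.1), (hT'mem v).mp (hNT' hv.1), ?_⟩
          exact C'.adjacent_of_reads ((C.reads_var_removeGate_iff k₀ ε u z).mpr hu.2)
            ((C.reads_var_removeGate_iff k₀ ε v z).mpr hv.2)
      · left
        rw [not_nonempty_iff_eq_empty.mp hne, card_empty]
        exact zero_le_one
  have hQN : ∀ p ∈ Pold, p.1 ∉ N ∧ p.2 ∉ N := by
    intro p hp
    have hp' := hPmT p (filter_subset _ _ hp)
    rw [hN]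
    exact ⟨fun h => (mem_sdiff.mp h).2 hp'.1, fun h => (mem_sdiff.mp h).2 hp'.2⟩
  obtain ⟨Q', hsubQ, hcardN, hnew, hnewdis⟩ := exists_pairs_cover Adj Pold N (A 0) (A 1) hNcov
    (hAgood 0) (hAgood 1) (filter_subset _ _) (filter_subset _ _) hQN
  -- (4) `Q'` is a packing of `C'`
  have hPoldPm : Pold ⊆ Pm := filter_subset _ _
  refine ⟨Q', ⟨fun p hp => ?_, fun p hp p' hp' hne => ?_⟩, ?_⟩
  · by_cases hpo : p ∈ Pold
    · have hpm := hPoldPm hpo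
      rw [hPold, mem_filter] at hpo
      rw [hPm, mem_filter] at hpm
      obtain ⟨hne, -, -, hadj⟩ := hP.1 _ hpm.2
      refine ⟨fun h => hne (by simp [h]), (hT'mem _).mp hpo.2.1, (hT'mem _).mp hpo.2.2, ?_⟩
      exact C.adjacent_removeGate_of k₀ ε p.1 p.2 hadj
    · obtain ⟨hne, -, -, hT1, hT2, hadj⟩ := hnew p (mem_sdiff.mpr ⟨hp, hpo⟩)
      exact ⟨hne, hT1, hT2, hadj⟩
  · by_cases hpo : p ∈ Pold <;> by_cases hpo' : p' ∈ Pold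
    · exact hPm_dis p (hPoldPm hpo) p' (hPoldPm hpo') hne
    · -- old versus new: old components are in `Told`, new ones in `N`
      have ho := hPmT p (hPoldPm hpo)
      obtain ⟨-, hn1, hn2, -⟩ := hnew p' (mem_sdiff.mpr ⟨hp', hpo'⟩)
      rw [hN, mem_sdiff] at hn1 hn2
      exact ⟨fun h => hn1.2 (h ▸ ho.1), fun h => hn2.2 (h ▸ ho.1), fun h => hn1.2 (h ▸ ho.2),
        fun h => hn2.2 (h ▸ ho.2)⟩
    · have ho := hPmT p' (hPoldPm hpo')
      obtain ⟨-, hn1, hn2, -⟩ := hnew p (mem_sdiff.mpr ⟨hp, hpo⟩)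
      rw [hN, mem_sdiff] at hn1 hn2
      exact ⟨fun h => hn1.2 (h ▸ ho.1), fun h => hn1.2 (h ▸ ho.2), fun h => hn2.2 (h ▸ ho.1),
        fun h => hn2.2 (h ▸ ho.2)⟩
    · exact hnewdis p (mem_sdiff.mpr ⟨hp, hpo⟩) p' (mem_sdiff.mpr ⟨hp', hpo'⟩) hne
  · -- (5) the count
    have hT'card : N.card + (T' ∩ Told).card = T'.card := card_sdiff_add_card_inter T' Told
    have hToldsplit : (Told \ T').card + (Told ∩ T').card = Told.card := card_sdiff_add_card_inter Told T'
    have hinter : T' ∩ Told = Told ∩ T' := inter_comm _ _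
    have hTold_le : Told.card ≤ C.troubledCount := by
      unfold troubledCount
      refine card_le_card_of_injOn (fun k => (ε k : Fin C.m)) (fun k hk => ?_) fun k _ k' _ h =>
        ε.injective (Subtype.ext h)
      simpa [hTold] using hk
    have hPold_le : Pold.card ≤ Q'.card := card_le_card hsubQ
    have ht' : C'.troubledCount = T'.card := by
      unfold troubledCount; rw [hT']
    unfold potential
    rw [ht']
    rw [hinter] at hT'card
    -- the inputs of `k₀` that are constants contribute nothing
    set c := ((univ : Finset (Fin 2)).filter fun a => ∀ b, C.arg k₀ a ≠ .const b).card with hc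
    have hAempty : ∀ a b, C.arg k₀ a = .const b → A a = ∅ := by
      intro a b hI
      refine filter_eq_empty_iff.mpr fun k _ h => ?_
      rw [hI] at h
      rcases h with h | ⟨z, h, -⟩ <;> simp at h
    have hind : ∀ a, (if A a = ∅ then 0 else 1) ≤ (if (∀ b, C.arg k₀ a ≠ .const b) then 1 else 0) := by
      intro a
      by_cases h : ∀ b, C.arg k₀ a ≠ .const b
      · rw [if_pos h]; split_ifs <;> omega
      · push Not at h
        obtain ⟨b, hb⟩ := h
        rw [if_pos (hAempty a b hb), if_neg (fun h' => h' b hb)]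
    have hcsum : c = (if (∀ b, C.arg k₀ 0 ≠ .const b) then 1 else 0) +
        (if (∀ b, C.arg k₀ 1 ≠ .const b) then 1 else 0) := by
      rw [hc, card_filter, Fin.sum_univ_two]
    have h0' := hind 0
    have h1' := hind 1
    have hnat : T'.card + P.card ≤ C.troubledCount + Q'.card + c := by omega
    have hreal : (T'.card : ℝ) + P.card ≤ C.troubledCount + Q'.card + c := by exact_mod_cast hnat
    linarith

/-- Influential inputs can only disappear when a gate is deleted (out-degrees do not grow).
[cite: LiYang2022, Def. 3.6] -/
theorem influential_removeGate_subset (h0 : ∀ k a, C.arg k a ≠ .gate k₀) (R : RdqSource n) :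
    (C.removeGate k₀ ε).influential R ⊆ C.influential R := by
  classical
  intro i hi
  unfold influential at hi ⊢
  rw [mem_filter] at hi ⊢
  refine ⟨mem_univ _, hi.2.imp_left fun h => ?_⟩
  have := C.fanout_removeGate_var_add k₀ ε h0 i
  omega

/-- **Normalization Rule 1, packaged** (Li–Yang §3.3, Lemma 3.11): deleting a `0`-gate `k₀` that
is not the output from a fair semicircuit computing `f|_R` with packing `𝒫` gives a fair
semicircuit computing `f|_R` with one gate fewer and a packing `𝒫'` such that
`μ(C', 𝒫', R) ≤ μ(C, 𝒫, R) - 1 + α_φ · c`, where `c ≤ 2` is the number of inputs of `k₀` that are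
not constants (so `Δμ ≥ 1 - 2α_φ`, and `≥ 1 - α_φ` when `k₀` is fed by a constant).
[cite: LiYang2022, Lemma 3.11 (Rule 1)] -/
theorem measure_removeGate_le {f : (Fin n → ZMod 2) → Bool} {R : RdqSource n} (hF : C.Fair)
    (hC : C.ComputesRestr f R) {P : Finset (Fin C.m × Fin C.m)} (hP : C.IsPacking P)
    (h0 : ∀ k a, C.arg k a ≠ .gate k₀) (hout : C.out ≠ .gate k₀)
    {αφ αI : ℝ} (hφ : 0 ≤ αφ) (hI : 0 ≤ αI) (αQ : ℝ) :
    ∃ P' : Finset (Fin m' × Fin m'), (C.removeGate k₀ ε).Fair ∧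
      (C.removeGate k₀ ε).ComputesRestr f R ∧ (C.removeGate k₀ ε).IsPacking P' ∧ m' + 1 = C.m ∧
      (C.removeGate k₀ ε).measure αφ αI αQ P' R ≤ C.measure αφ αI αQ P R - 1 +
        αφ * ((univ : Finset (Fin 2)).filter fun a => ∀ b, C.arg k₀ a ≠ .const b).card := by
  obtain ⟨P', hP', hpot⟩ := C.exists_packing_removeGate k₀ ε h0 hP
  refine ⟨P', hF.removeGate ε h0, hC.removeGate ε hF h0 hout, hP', C.removeGate_m_add_one k₀ ε, ?_⟩
  have hinf : (((C.removeGate k₀ ε).influential R).card : ℝ) ≤ (C.influential R).card := by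
    exact_mod_cast card_le_card (C.influential_removeGate_subset k₀ ε h0 R)
  have hm : ((m' : ℕ) : ℝ) + 1 = C.m := by exact_mod_cast C.removeGate_m_add_one k₀ ε
  unfold measure
  show (m' : ℝ) + _ + _ + _ ≤ _
  nlinarith [mul_le_mul_of_nonneg_left hinf hI, mul_le_mul_of_nonneg_left hpot hφ]

/-- There are at most two non-constant inputs. [folklore] -/
theorem card_nonconst_inputs_le_two :
    ((univ : Finset (Fin 2)).filter fun a => ∀ b, C.arg k₀ a ≠ .const b).card ≤ 2 :=
  (card_filter_le _ _).trans (by simp)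

/-- If `k₀` is fed by a constant, at most one input is not a constant. [folklore] -/
theorem card_nonconst_inputs_le_one {a₀ : Fin 2} {b : Bool} (h : C.arg k₀ a₀ = .const b) :
    ((univ : Finset (Fin 2)).filter fun a => ∀ b, C.arg k₀ a ≠ .const b).card ≤ 1 := by
  refine Nat.le_of_lt_succ ((card_lt_card ⟨filter_subset _ _, fun hsub => ?_⟩).trans_le (by simp))
  have := (mem_filter.mp (hsub (mem_univ a₀))).2 b
  exact this h

/-- **The canonical reindexing** after deleting gate `k₀`: `Fin (m - 1) ≃ {k ≠ k₀}`. [folklore] -/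
noncomputable def skipEquiv (k₀ : Fin C.m) : Fin (C.m - 1) ≃ {k : Fin C.m // k ≠ k₀} :=
  (Fintype.equivFinOfCardEq (by simp)).symm

variable {C k₀} in
/-- **Rule 1** (Li–Yang Lemma 3.11): a `0`-gate other than the output can be deleted, with
`Δμ ≥ 1 - 2α_φ`, keeping fairness, `f|_R`, and a packing. [cite: LiYang2022, Lemma 3.11 (Rule 1)] -/
theorem rule1 {f : (Fin n → ZMod 2) → Bool} {R : RdqSource n} (hF : C.Fair)
    (hC : C.ComputesRestr f R) {P : Finset (Fin C.m × Fin C.m)} (hP : C.IsPacking P)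
    (h0 : C.fanout (.gate k₀) = 0) (hout : C.out ≠ .gate k₀)
    {αφ αI : ℝ} (hφ : 0 ≤ αφ) (hI : 0 ≤ αI) (αQ : ℝ) :
    ∃ (C' : Semicircuit n) (P' : Finset (Fin C'.m × Fin C'.m)), C'.Fair ∧ C'.ComputesRestr f R ∧
      C'.IsPacking P' ∧ C'.m + 1 = C.m ∧
      C'.measure αφ αI αQ P' R ≤ C.measure αφ αI αQ P R - (1 - 2 * αφ) := by
  have h0' := (C.fanout_eq_zero_iff _).mp h0
  obtain ⟨P', hF', hC', hP', hm, hμ⟩ :=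
    C.measure_removeGate_le k₀ (C.skipEquiv k₀) hF hC hP h0' hout hφ hI αQ
  refine ⟨C.removeGate k₀ (C.skipEquiv k₀), P', hF', hC', hP', hm, ?_⟩
  have hc : (((univ : Finset (Fin 2)).filter fun a => ∀ b, C.arg k₀ a ≠ .const b).card : ℝ) ≤ 2 := by
    exact_mod_cast C.card_nonconst_inputs_le_two k₀
  nlinarith [mul_le_mul_of_nonneg_left hc hφ]

variable {C k₀} in
/-- **Rule 1 for a gate fed by a constant**: `Δμ ≥ 1 - α_φ`. [cite: LiYang2022, Lemma 3.11] -/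
theorem rule1_of_const {f : (Fin n → ZMod 2) → Bool} {R : RdqSource n} (hF : C.Fair)
    (hC : C.ComputesRestr f R) {P : Finset (Fin C.m × Fin C.m)} (hP : C.IsPacking P)
    (h0 : C.fanout (.gate k₀) = 0) (hout : C.out ≠ .gate k₀) {a₀ : Fin 2} {b : Bool}
    (hconst : C.arg k₀ a₀ = .const b) {αφ αI : ℝ} (hφ : 0 ≤ αφ) (hI : 0 ≤ αI) (αQ : ℝ) :
    ∃ (C' : Semicircuit n) (P' : Finset (Fin C'.m × Fin C'.m)), C'.Fair ∧ C'.ComputesRestr f R ∧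
      C'.IsPacking P' ∧ C'.m + 1 = C.m ∧
      C'.measure αφ αI αQ P' R ≤ C.measure αφ αI αQ P R - (1 - αφ) := by
  have h0' := (C.fanout_eq_zero_iff _).mp h0
  obtain ⟨P', hF', hC', hP', hm, hμ⟩ :=
    C.measure_removeGate_le k₀ (C.skipEquiv k₀) hF hC hP h0' hout hφ hI αQ
  refine ⟨C.removeGate k₀ (C.skipEquiv k₀), P', hF', hC', hP', hm, ?_⟩
  have hc : (((univ : Finset (Fin 2)).filter fun a => ∀ b, C.arg k₀ a ≠ .const b).card : ℝ) ≤ 1 := by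
    exact_mod_cast C.card_nonconst_inputs_le_one k₀ hconst
  nlinarith [mul_le_mul_of_nonneg_left hc hφ]

end Rule1

end Semicircuit


/-- Negating inputs of a ⊕-type function gives a ⊕-type function. [folklore] -/
theorem IsXorOp.comp_xor {op : Bool → Bool → Bool} (h : IsXorOp op) (s₀ s₁ : Bool) :
    IsXorOp fun a b => op (a ^^ s₀) (b ^^ s₁) := by
  obtain ⟨c, hc⟩ := h
  refine ⟨(c ^^ s₀) ^^ s₁, fun a b => ?_⟩
  show op (a ^^ s₀) (b ^^ s₁) = _
  rw [hc]
  cases a <;> cases b <;> cases c <;> cases s₀ <;> cases s₁ <;> rfl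

/-- Negating inputs of an ∧-type function gives an ∧-type function. [folklore] -/
theorem IsAndOp.comp_xor {op : Bool → Bool → Bool} (h : IsAndOp op) (s₀ s₁ : Bool) :
    IsAndOp fun a b => op (a ^^ s₀) (b ^^ s₁) := by
  obtain ⟨c₁, c₂, c₃, hc⟩ := h
  refine ⟨c₁ ^^ s₀, c₂ ^^ s₁, c₃, fun a b => ?_⟩
  show op (a ^^ s₀) (b ^^ s₁) = _
  rw [hc]
  cases a <;> cases b <;> cases c₁ <;> cases c₂ <;> cases s₀ <;> cases s₁ <;> rfl

namespace Semicircuit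

variable {n : ℕ} (C : Semicircuit n)

/-- The admissible replacement nodes for the wires out of gate `k₀`: a wire of `k₀` itself, or a
node that is not a gate (a constant or a variable). This keeps the xor-part closed and the
acyclic part acyclic. [folklore] -/
def RedirectOK (k₀ : Fin C.m) (v : Node n C.m) : Prop :=
  (∃ a, C.arg k₀ a = v) ∨ ∀ k', v ≠ .gate k'

/-- **Redirecting the wires out of a gate** `k₀` to the node `v`, negating those inputs if
`neg` (the rewiring step of normalization Rules 2 and 3 of Li–Yang §3.3: the descendants of a
trivialized gate "become fed by a constant `c` instead"; the descendants of a degenerate gate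
"become directly fed by `I₁`", and "if `G` computes the negation of `I₁`, the functions of the
descendants should be modified accordingly"). Gate `k₀` itself stays (now a `0`-gate, to be
deleted by `removeGate`); the output node is unchanged. [cite: LiYang2022, §3.3 (Rules 2, 3)] -/
abbrev redirect (k₀ : Fin C.m) (v : Node n C.m) (neg : Bool) (hv : C.RedirectOK k₀ v) : Semicircuit n where
  m := C.m
  op k b₀ b₁ := C.op k (b₀ ^^ (neg && decide (C.arg k 0 = .gate k₀)))
    (b₁ ^^ (neg && decide (C.arg k 1 = .gate k₀)))
  arg k a := if C.arg k a = .gate k₀ then v else C.arg k a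
  out := C.out
  xorPart := C.xorPart
  isXorOp_of_mem k hk := (C.isXorOp_of_mem k hk).comp_xor _ _
  mem_of_arg_eq k hk a k' h := by
    by_cases hr : C.arg k a = .gate k₀
    · rw [if_pos hr] at h
      have hk₀ : k₀ ∈ C.xorPart := C.mem_of_arg_eq k hk a k₀ hr
      rcases hv with ⟨a₀, ha₀⟩ | hng
      · exact C.mem_of_arg_eq k₀ hk₀ a₀ k' (ha₀.trans h)
      · exact absurd h (hng k')
    · rw [if_neg hr] at h
      exact C.mem_of_arg_eq k hk a k' h
  acyclic := by
    obtain ⟨ρ, hρ⟩ := C.acyclic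
    refine ⟨ρ, fun k hk a k' h hk' => ?_⟩
    by_cases hr : C.arg k a = .gate k₀
    · rw [if_pos hr] at h
      rcases hv with ⟨a₀, ha₀⟩ | hng
      · have h0 : k₀ ∉ C.xorPart := fun hk₀ => hk' (C.mem_of_arg_eq k₀ hk₀ a₀ k' (ha₀.trans h))
        exact (hρ k₀ h0 a₀ k' (ha₀.trans h) hk').trans (hρ k hk a k₀ hr h0)
      · exact absurd h (hng k')
    · rw [if_neg hr] at h
      exact hρ k hk a k' h hk'

section Redirect

variable (k₀ : Fin C.m) (v : Node n C.m) (neg : Bool) (hv : C.RedirectOK k₀ v)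

/-- Number of gates is unchanged. [folklore] -/
theorem redirect_m : (C.redirect k₀ v neg hv).m = C.m := rfl

/-- Wires after redirection. [folklore] -/
theorem redirect_arg (k : Fin C.m) (a : Fin 2) :
    (C.redirect k₀ v neg hv).arg k a = if C.arg k a = .gate k₀ then v else C.arg k a := rfl

/-- Output is unchanged. [folklore] -/
theorem redirect_out : (C.redirect k₀ v neg hv).out = C.out := rfl

/-- Node values are computed by the same function. [folklore] -/
theorem nodeVal_redirect_eq (x : Fin n → Bool) (w : Fin C.m → Bool) (u : Node n C.m) :
    (C.redirect k₀ v neg hv).nodeVal x w u = C.nodeVal x w u := by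
  cases u <;> rfl

/-- The input read at position `a` of gate `k` after redirection, given that gate `k₀` carries the
value `v ⊕ neg`. [folklore] -/
theorem op_input_redirect (x : Fin n → Bool) (w : Fin C.m → Bool)
    (hw₀ : w k₀ = (C.nodeVal x w v ^^ neg)) (k : Fin C.m) (a : Fin 2) :
    (C.nodeVal x w (if C.arg k a = .gate k₀ then v else C.arg k a) ^^
        (neg && decide (C.arg k a = .gate k₀))) = C.nodeVal x w (C.arg k a) := by
  by_cases hr : C.arg k a = .gate k₀
  · rw [if_pos hr, decide_eq_true hr, Bool.and_true, hr]
    show _ = w k₀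
    rw [hw₀]
  · rw [if_neg hr, decide_eq_false hr, Bool.and_false, Bool.xor_false]

/-- **Gate equations after redirection** are equivalent to the old ones, provided gate `k₀` does
not read itself and its own equation forces the value `v ⊕ neg` (as for a gate fed by a constant:
trivialized, `v` the constant it computes; or degenerate, `v` its other input). [folklore] -/
theorem consistent_redirect_iff (hself : ∀ a, C.arg k₀ a ≠ .gate k₀)
    (hid : ∀ (x : Fin n → Bool) (w : Fin C.m → Bool),
      C.op k₀ (C.nodeVal x w (C.arg k₀ 0)) (C.nodeVal x w (C.arg k₀ 1)) = (C.nodeVal x w v ^^ neg))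
    (x : Fin n → Bool) (w : Fin C.m → Bool) :
    (C.redirect k₀ v neg hv).Consistent x w ↔ C.Consistent x w := by
  unfold Consistent
  simp only [nodeVal_redirect_eq]
  have hk₀eq : ∀ w : Fin C.m → Bool,
      (w k₀ = C.op k₀ (C.nodeVal x w (if C.arg k₀ 0 = .gate k₀ then v else C.arg k₀ 0) ^^
          (neg && decide (C.arg k₀ 0 = .gate k₀)))
        (C.nodeVal x w (if C.arg k₀ 1 = .gate k₀ then v else C.arg k₀ 1) ^^
          (neg && decide (C.arg k₀ 1 = .gate k₀)))) ↔
      w k₀ = C.op k₀ (C.nodeVal x w (C.arg k₀ 0)) (C.nodeVal x w (C.arg k₀ 1)) := by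
    intro w
    rw [if_neg (hself 0), if_neg (hself 1), decide_eq_false (hself 0), decide_eq_false (hself 1)]
    simp
  constructor
  · intro h k
    have hw₀ : w k₀ = (C.nodeVal x w v ^^ neg) := by rw [(hk₀eq w).mp (h k₀), hid]
    have := h k
    rwa [C.op_input_redirect k₀ v neg x w hw₀ k 0, C.op_input_redirect k₀ v neg x w hw₀ k 1] at this
  · intro h k
    have hw₀ : w k₀ = (C.nodeVal x w v ^^ neg) := by rw [h k₀, hid]
    rw [C.op_input_redirect k₀ v neg x w hw₀ k 0, C.op_input_redirect k₀ v neg x w hw₀ k 1]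
    exact h k

variable {C k₀ v neg hv} in
/-- **Redirection preserves fairness** (same solution sets). [cite: LiYang2022, §3.3 (Rules 2, 3)] -/
theorem Fair.redirect (hF : C.Fair) (hself : ∀ a, C.arg k₀ a ≠ .gate k₀)
    (hid : ∀ (x : Fin n → Bool) (w : Fin C.m → Bool),
      C.op k₀ (C.nodeVal x w (C.arg k₀ 0)) (C.nodeVal x w (C.arg k₀ 1)) = (C.nodeVal x w v ^^ neg)) :
    (C.redirect k₀ v neg hv).Fair := fun x => by
  obtain ⟨w, hw, huniq⟩ := hF x
  exact ⟨w, (C.consistent_redirect_iff k₀ v neg hv hself hid x w).mpr hw,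
    fun w' hw' => huniq w' ((C.consistent_redirect_iff k₀ v neg hv hself hid x w').mp hw')⟩

/-! #### Out-degrees after redirection -/

/-- **Gate `k₀` becomes a `0`-gate.** [cite: LiYang2022, §3.3 (Rules 2, 3)] -/
theorem fanout_redirect_self (hvk : v ≠ .gate k₀) : (C.redirect k₀ v neg hv).fanout (.gate k₀) = 0 := by
  unfold fanout
  refine sum_eq_zero fun k _ => ?_
  rw [card_eq_zero, filter_eq_empty_iff]
  intro a _
  rw [redirect_arg]
  split_ifs with h
  · exact hvk
  · exact h

/-- Nodes other than `k₀` and `v` keep their out-degree. [folklore] -/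
theorem fanout_redirect_of_ne {u : Node n C.m} (hu : u ≠ .gate k₀) (huv : u ≠ v) :
    (C.redirect k₀ v neg hv).fanout u = C.fanout u := by
  unfold fanout
  refine sum_congr rfl fun k _ => ?_
  congr 1
  ext a
  simp only [mem_filter, mem_univ, true_and]
  split_ifs with h
  · rw [h]
    exact ⟨fun h' => absurd h'.symm huv, fun h' => absurd h' hu.symm⟩
  · exact Iff.rfl

/-- **The replacement node inherits the wires of `k₀`**: its out-degree grows by the old
out-degree of `k₀`. [cite: LiYang2022, §3.3 (Rule 3)] -/
theorem fanout_redirect_target (hvk : v ≠ .gate k₀) :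
    (C.redirect k₀ v neg hv).fanout v = C.fanout v + C.fanout (.gate k₀) := by
  unfold fanout
  rw [← sum_add_distrib]
  refine sum_congr rfl fun k _ => ?_
  rw [← card_union_of_disjoint]
  · congr 1
    ext a
    simp only [mem_filter, mem_univ, true_and, mem_union]
    split_ifs with h
    · simp [h, hvk.symm]
    · simp [h]
  · rw [disjoint_filter]
    intro a _ h1 h2
    rw [h1] at h2
    exact hvk h2

/-! #### Computing `f|_R` after redirection -/

variable {C k₀ v neg hv} in
/-- **Redirection keeps computing `f|_R`** (the output node and the solutions are unchanged; a
variable target is a wire of `k₀`, hence free). [cite: LiYang2022, §3.3 (Rules 2, 3)] -/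
theorem ComputesRestr.redirect {f : (Fin n → ZMod 2) → Bool} {R : RdqSource n}
    (hC : C.ComputesRestr f R) (hself : ∀ a, C.arg k₀ a ≠ .gate k₀)
    (hid : ∀ (x : Fin n → Bool) (w : Fin C.m → Bool),
      C.op k₀ (C.nodeVal x w (C.arg k₀ 0)) (C.nodeVal x w (C.arg k₀ 1)) = (C.nodeVal x w v ^^ neg))
    (hvar : ∀ i, v = .var i → ∃ a, C.arg k₀ a = .var i) :
    (C.redirect k₀ v neg hv).ComputesRestr f R := by
  refine ⟨fun i hi => ?_, fun u hu w hw => ?_⟩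
  · have h0 := hC.1 i hi
    by_cases hiv : Node.var i = v
    · -- `x_i` is a wire of `k₀`, so its out-degree in `C` is positive: contradiction
      exfalso
      obtain ⟨a, ha⟩ := hvar i hiv.symm
      have : 0 < C.fanout (.var i) := by
        unfold fanout
        refine Nat.pos_of_ne_zero fun hsum => ?_
        have := (sum_eq_zero_iff.mp hsum) k₀ (mem_univ _)
        rw [card_eq_zero, filter_eq_empty_iff] at this
        exact this (mem_univ a) ha
      omega
    · rw [C.fanout_redirect_of_ne k₀ v neg hv (by simp) hiv]
      exact h0
  · rw [C.consistent_redirect_iff k₀ v neg hv hself hid] at hw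
    rw [redirect_out, nodeVal_redirect_eq]
    exact hC.2 u hu w hw

end Redirect

end Semicircuit

end Literature.Computability.Complexity
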